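import Summits.QuantumFields.YangMills.Theses.GronwallGap
import Literature.MathematicalPhysics.QuantumFieldTheory.TorusClassDirectionKPLog

/-!
# Crux `AnalyticDetour` (stmt-QuantumFields-8801), line `registered`:
# the stub `stub_finiteVolumeKPLog` (strong coupling, complex class-function direction: the
# finite-volume torus pressure extends holomorphically to the unit disc, bounded uniformly in the
# volume)

Registered stub of the skeleton `Cruxes/AnalyticDetour/Lines/registered.lean` (route
`GronwallGap`, sub-problem `YangMills`), proved verbatim.  For a compact second-countable group
`G` with a Borel σ-algebra there are `η > 0` and `B` such that for all continuous `a b : G → ℝ`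
with `|a| + |b| ≤ η` pointwise and every torus side `L+1`, the finite-volume pressure
`t ↦ (L+1)⁻⁴ log ∫ ∏_q exp (a(U_q) + t b(U_q)) d(⊗_e Haar)` of the pure plaquette lattice gauge
theory on `(ℤ/(L+1)ℤ)^4` is the restriction to `(-1, 1)` of a function holomorphic on the unit
disc and bounded by `B` there.  In the line this is the finite-volume half of the Vitali argument
of `stub_nearHaarAnalytic` (analyticity of the pressure near the Haar point in every continuous
class-function direction); the real-axis limits are `stub_torusPressureLimit`.

Proof: the `d = 4`, `L ↦ L+1` case of the Literature theorem
`Literature.MathematicalPhysics.QuantumFieldTheory.exists_differentiableOn_torusPressure_classDirection`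
(`Literature/MathematicalPhysics/QuantumFieldTheory/TorusClassDirectionKPLog.lean`, with the
generic layer in `LocalFactorKPLogParam.lean`): the Kotecký–Preiss logarithm `pertLogZ` of the
torus plaquette gas (`torusSystem`, `StrongCouplingTorusSystem`) with the complex cell factors
`exp (a(U_q) + z b(U_q)) − 1`, `‖·‖ ≤ 2η` on the closed unit disc, under the smallness
`e (2η) (3^d d² + 1)² = 1/2`; it is holomorphic in `z` (`differentiableOn_pertLogZ_param`, from
`differentiableOn_polymerLogZ_param` and the zero-freeness of the scaled Kotecký–Preiss volumes),
bounded by `#labels · (Δ+1) · 2e(2η) ≤ 16 (L+1)⁴ · const` (`norm_pertLogZ_le`), and for real `z` it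
is the real logarithm of the torus partition function (`pertLogZ_eq_ofReal_log`,
`map_torusSigma_zdHaar`, `Plaquette ≃ torusGenuine`).  The Hausdorff hypothesis of the registered
signature is not used.

No named facts are used; no definitions are introduced.
-/

namespace Summit.QuantumFields.YangMills.Theorems

/-- **Stub `stub_finiteVolumeKPLog` — strong coupling, complex class direction, finite volume.**
There are `η > 0` and `B` such that for continuous `a b : G → ℝ` with `|a| + |b| ≤ η` pointwise
and every torus side `L+1`, the finite-volume pressure
`t ↦ (L+1)⁻⁴ log ∫ ∏_q exp (a(U_q) + t b(U_q))` is the restriction to `(-1, 1)` of a function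
holomorphic on the unit disc and bounded by `B` there (Kotecký–Preiss logarithm of the plaquette
gas with cell factors `exp (a + t b) − 1` on `torusSystem`; zero-freeness,
`‖log Z‖ ≤ #cells (Δ+1) 2eε`, holomorphy in `t`, reality for real `t`: the `d = 4` case of
`Literature.MathematicalPhysics.QuantumFieldTheory.exists_differentiableOn_torusPressure_classDirection`,
Osterwalder–Seiler 1978 §3 and Thm. 3.7). -/
theorem stub_finiteVolumeKPLog :
    ∀ (G : Type) [Group G] [TopologicalSpace G] [IsTopologicalGroup G] [CompactSpace G] [T2Space G] [SecondCountableTopology G] [MeasurableSpace G] [BorelSpace G], ∃ η : ℝ, 0 < η ∧ ∃ B : ℝ, ∀ a b : G → ℝ, Continuous a → Continuous b → (∀ g : G, |a g| + |b g| ≤ η) → ∀ L : ℕ, ∃ F : ℂ → ℂ, DifferentiableOn ℂ F (Metric.ball 0 1) ∧ (∀ z ∈ Metric.ball (0 : ℂ) 1, ‖F z‖ ≤ B) ∧ ∀ t : ℝ, |t| < 1 → F (t : ℂ) = (((((L + 1 : ℕ) : ℝ) ^ 4)⁻¹ * Real.log (∫ U : Literature.MathematicalPhysics.QuantumFieldTheory.GaugeConfig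 4 (L + 1) G, ∏ q : Literature.MathematicalPhysics.QuantumFieldTheory.Plaquette 4 (L + 1), Real.exp (a (Literature.MathematicalPhysics.QuantumFieldTheory.plaquetteHolonomy U q.1 q.2.1.1 q.2.1.2) + t * b (Literature.MathematicalPhysics.QuantumFieldTheory.plaquetteHolonomy U q.1 q.2.1.1 q.2.1.2)) ∂(MeasureTheory.Measure.pi fun _ : Literature.MathematicalPhysics.QuantumFieldTheory.Edge 4 (L + 1) => Literature.MathematicalPhysics.QuantumFieldTheory.haarProbability G)) : ℝ) : ℂ) := by
  intro G _ _ _ _ _ _ _ _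
  obtain ⟨η, hη, B, h⟩ :=
    Literature.MathematicalPhysics.QuantumFieldTheory.exists_differentiableOn_torusPressure_classDirection
      4 G
  exact ⟨η, hη, B, fun a b ha hb hab L => h a b ha hb hab (L + 1)⟩

end Summit.QuantumFields.YangMills.Theorems
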